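import Mathlib
import Summits.Ventures.PercRepro2.CoinKStar

/-!
# The LITERAL k-STAR (blind cell PercRepro2, night-2 g5; proofs/NIGHT2-DARC.md §26)

`darc_of_kStar_coins`: the `2k` single-arc coins `c v = {w → v}`, `d v = {v → t}` (`v ∈ Vs`) are
the only coins with tails in `P = {w} ∪ Vs` (`OnlyKStarCoins`), any probabilities, arbitrary
entries into the star and arbitrary rest of the system (`SameEnds`), `t ∉ P`, `a, b, u ∉ P ∪ {t}`,
the reduced avoidance events of positive probability ⟹ row 2′DARC at the arc `u → w`.  The
structural hypotheses of `darc_of_kStar_mixed` (`ClosedOut`, `TailCoinsIn`, the leaf and head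
reachability events, injectivity) are derived here from the coin description.
-/

namespace Summit.Ventures.PercRepro2.Coin

section KStarCoins

variable {V : Type*} {E : Type*} [DecidableEq V]

/-- The `2k` star coins are the only coins carrying an arc with tail in `{w} ∪ Vs`. -/
def OnlyKStarCoins (arcs : E → Finset (V × V)) (w : V) (Vs : Finset V) (c d : V → E) : Prop :=
  ∀ e, (∃ xy ∈ arcs e, xy.1 = w ∨ xy.1 ∈ Vs) → (∃ v ∈ Vs, e = c v) ∨ (∃ v ∈ Vs, e = d v)

variable {arcs : E → Finset (V × V)} {w t : V} {Vs : Finset V} {c d : V → E}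
  (hc : ∀ v ∈ Vs, arcs (c v) = {(w, v)}) (hd : ∀ v ∈ Vs, arcs (d v) = {(v, t)})
  (honly : OnlyKStarCoins arcs w Vs c d)

include hc hd honly

omit [DecidableEq V] in
/-- An arc with tail in the star is an arm arc or a leaf arc. -/
lemma kStar_arc {e : E} {x y : V} (hxy : (x, y) ∈ arcs e) (hx : x = w ∨ x ∈ Vs) :
    (∃ v ∈ Vs, e = c v ∧ x = w ∧ y = v) ∨ (∃ v ∈ Vs, e = d v ∧ x = v ∧ y = t) := by
  rcases honly e ⟨(x, y), hxy, hx⟩ with ⟨v, hv, rfl⟩ | ⟨v, hv, rfl⟩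
  · rw [hc v hv, Finset.mem_singleton, Prod.mk.injEq] at hxy
    exact Or.inl ⟨v, hv, rfl, hxy.1, hxy.2⟩
  · rw [hd v hv, Finset.mem_singleton, Prod.mk.injEq] at hxy
    exact Or.inr ⟨v, hv, rfl, hxy.1, hxy.2⟩

/-- The star is closed out into `{t}`. -/
lemma kStar_closedOut : ClosedOut arcs (insert w Vs) {t} := by
  intro e xy hxy hx
  simp only [Finset.mem_insert] at hx
  rcases kStar_arc hc hd honly hxy hx with ⟨v, hv, _, _, hy⟩ | ⟨v, _, _, _, hy⟩
  · exact Finset.mem_union_left _ (hy ▸ Finset.mem_insert_of_mem hv)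
  · exact Finset.mem_union_right _ (hy ▸ Finset.mem_singleton_self t)

/-- The star coins carry only arcs with tails in the star. -/
lemma kStar_tailCoinsIn : TailCoinsIn arcs (insert w Vs) {t} := by
  intro e he xy hxy
  obtain ⟨x'y', hx'y', hx'⟩ := he
  simp only [Finset.mem_insert] at hx'
  rcases kStar_arc hc hd honly hx'y' hx' with ⟨v, hv, rfl, _, _⟩ | ⟨v, hv, rfl, _, _⟩
  · rw [hc v hv, Finset.mem_singleton] at hxy; subst hxy
    exact Finset.mem_union_left _ (Finset.mem_insert_self w Vs)
  · rw [hd v hv, Finset.mem_singleton] at hxy; subst hxy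
    exact Finset.mem_union_left _ (Finset.mem_insert_of_mem hv)

omit hd honly in
omit [DecidableEq V] in
/-- The arm coins are injective on the leaves. -/
lemma kStar_c_injOn : Set.InjOn c Vs := by
  intro v hv v' hv' h
  have h1 := hc v hv
  have h2 := hc v' hv'
  rw [h] at h1
  rw [h1, Finset.singleton_inj, Prod.mk.injEq] at h2
  exact h2.2

omit hc honly in
omit [DecidableEq V] in
/-- The leaf coins are injective on the leaves. -/
lemma kStar_d_injOn : Set.InjOn d Vs := by
  intro v hv v' hv' h
  have h1 := hd v hv
  have h2 := hd v' hv'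
  rw [h] at h1
  rw [h1, Finset.singleton_inj, Prod.mk.injEq] at h2
  exact h2.1

omit honly in
omit [DecidableEq V] in
/-- Arm and leaf coins are distinct. -/
lemma kStar_cd_ne (hwV : w ∉ Vs) : ∀ v ∈ Vs, ∀ v' ∈ Vs, c v ≠ d v' := by
  intro v hv v' hv' h
  have h1 := hc v hv
  have h2 := hd v' hv'
  rw [h] at h1
  rw [h1, Finset.singleton_inj, Prod.mk.injEq] at h2
  exact hwV (h2.1 ▸ hv')

omit [DecidableEq V] in
/-- A leaf reaches `t` iff its leaf coin is open. -/
lemma kStar_leaf (hwV : w ∉ Vs) (htV : t ∉ Vs) {v : V} (hv : v ∈ Vs) :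
    bwdEvent arcs v {t} = openEdge (d v) := by
  ext ω
  simp only [bwdEvent, Set.mem_setOf_eq, Finset.mem_singleton, exists_eq_left, openEdge]
  constructor
  · intro h
    rcases Relation.ReflTransGen.cases_head h with heq | ⟨y, ⟨e, he, hxy⟩, _⟩
    · exact absurd (heq ▸ hv) htV
    · rcases kStar_arc hc hd honly hxy (Or.inr hv) with ⟨v', _, _, hx, _⟩ | ⟨v', hv', rfl, hx, _⟩
      · exact absurd (hx ▸ hv) hwV
      · subst hx; exact he
  · intro h
    exact reach_of_openArc ⟨d v, h, by rw [hd v hv]; exact Finset.mem_singleton_self _⟩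

omit [DecidableEq V] in
/-- The head reaches `t` iff some arm and its leaf are both open. -/
lemma kStar_head (hwV : w ∉ Vs) (htV : t ∉ Vs) (hwt : w ≠ t) :
    bwdEvent arcs w {t} = ⋃ v ∈ Vs, (openEdge (c v) ∩ openEdge (d v)) := by
  ext ω
  simp only [Set.mem_iUnion, Set.mem_inter_iff, exists_prop]
  constructor
  · intro h
    simp only [bwdEvent, Set.mem_setOf_eq, Finset.mem_singleton, exists_eq_left] at h
    rcases Relation.ReflTransGen.cases_head h with heq | ⟨y, ⟨e, he, hxy⟩, hyt⟩
    · exact absurd heq hwt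
    · rcases kStar_arc hc hd honly hxy (Or.inl rfl) with ⟨v, hv, rfl, _, hyv⟩ | ⟨v, hv, _, hx, _⟩
      · refine ⟨v, hv, he, ?_⟩
        have hl := kStar_leaf hc hd honly hwV htV hv
        have hmem : ω ∈ bwdEvent arcs v {t} := by
          simp only [bwdEvent, Set.mem_setOf_eq, Finset.mem_singleton, exists_eq_left]
          exact hyv ▸ hyt
        rw [hl] at hmem
        exact hmem
      · exact absurd (hx ▸ hv) hwV
  · rintro ⟨v, hv, hcv, hdv⟩
    simp only [bwdEvent, Set.mem_setOf_eq, Finset.mem_singleton, exists_eq_left]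
    have h1 : Reach arcs ω w v :=
      reach_of_openArc ⟨c v, hcv, by rw [hc v hv]; exact Finset.mem_singleton_self _⟩
    have h2 : Reach arcs ω v t :=
      reach_of_openArc ⟨d v, hdv, by rw [hd v hv]; exact Finset.mem_singleton_self _⟩
    exact reach_trans h1 h2

end KStarCoins

section Theorem

open Classical

variable {V : Type*} {E : Type*} [Fintype V] [DecidableEq V] [Fintype E] [DecidableEq E]
  {R : Type*} [Field R] [LinearOrder R] [IsStrictOrderedRing R]

/-- **THEOREM (the literal k-star, row 2′DARC).** The `2k` single-arc coins `c v = {w → v}`,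
`d v = {v → t}` (`v ∈ Vs`) are the only coins with tails in `{w} ∪ Vs`; any probabilities;
entries into the star and the rest of the system arbitrary (`SameEnds`); `t ∉ {w} ∪ Vs`;
`a, b, u ∉ {w} ∪ Vs ∪ {t}`; the reduced avoidance events of positive probability.  Then
`Φ_D({s ↛ t in D + (u → w)}) ≥ 0`. -/
theorem darc_of_kStar_coins (p : E → R) (hp : IsProbVec p) {arcs : E → Finset (V × V)}
    (hS : SameEnds arcs) (s a b u w t : V) (Vs : Finset V) (hwV : w ∉ Vs) (htV : t ∉ Vs)
    (hwt : w ≠ t) {c d : V → E} (hc : ∀ v ∈ Vs, arcs (c v) = {(w, v)})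
    (hd : ∀ v ∈ Vs, arcs (d v) = {(v, t)}) (honly : OnlyKStarCoins arcs w Vs c d)
    (ha : a ∉ insert w Vs ∪ {t}) (hb : b ∉ insert w Vs ∪ {t}) (hu : u ∉ insert w Vs ∪ {t})
    (hP : ∀ Z ∈ (insert w Vs).powerset,
      0 < prob p (avoidEvent (arcsOff arcs (insert w Vs ∪ {t})) s (Z ∪ {t})))
    (hQ : ∀ Z ∈ (insert w Vs).powerset,
      0 < prob p (avoidEvent (arcsOff arcs (insert w Vs ∪ {t})) s (gateTarget u w Z {t}))) :
    DARC p arcs s {t} a b u w :=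
  darc_of_kStar_mixed p hp hS s a b u w t Vs hwV (kStar_closedOut hc hd honly)
    (kStar_tailCoinsIn hc hd honly) (kStar_cd_ne hc hd hwV) (kStar_c_injOn hc) (kStar_d_injOn hd)
    (fun _ hv => kStar_leaf hc hd honly hwV htV hv) (kStar_head hc hd honly hwV htV hwt)
    ha hb hu hP hQ

end Theorem

end Summit.Ventures.PercRepro2.Coin
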